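import Summits.QuantumFields.YangMills.Theorems.BalabanUVNodesN15NeumannCubeLiftSpacing
import Summits.QuantumFields.YangMills.Theorems.BalabanUVNodesN15NeumannCubeDivergenceDefect
import Summits.QuantumFields.YangMills.Theorems.BalabanUVNodesN15TwoSpacingGluingAdjoint
import HarnessLib

/-!
# Route «BalabanUVNodes» (K3⁷), node N15 = NE2, -a lane, PROGRAMME P file P-IIj: ENTRY 2 «G∇*» THROUGH THE LIFT — the window restriction commutes with the adjoint difference behind a
# multiplier supported one step inside the cube; the lifted sandwiched entry-2 rows at both spacings on the torus of record; their two-grid η-defect (N-IIg lifted)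

Cell `pub-ymgap`, seat `pub-ymgap-dag-n15-a` (KNIT-BY-NAME, g22; HUMAN RULING D-0062; chair R424 venue; `bears_on: R4∕N15`); `--kind proof --supports stmt-QuantumFields-20544 --as helper`.
Sequel of P-IId `…NeumannCubeLiftSpacing` (the any-spacing transfer, the OUTPUT-side adjoint rows) and N-IId ∕ N-IIg (`…NeumannCubeDivergence(Defect)`: the cube torus's sandwiched entry 2
and its η-defect).  CONSUMER: the entry-2 letters of FILE 50's `GluedLetters` on the TORUS OF RECORD (adjoint arrangement `(1 − R̃)⁻¹∘(G₀∘∇*)`, `G₀ = Σ_k M_{h_k}G_k^{↑}M_{h_k}`; dag-n15-c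
PLAN (3)): there `∇*` meets the lifted cube `G^{↑} = π^*∘G(□′)∘ρ_W` on its SOURCE side, behind the partition multiplier.

WHAT.  Big torus `M`, small (cube) torus `M′ ∣ M`, spacing `n`, cube `□ + c` of side `S ≤ M′_ν`, window `W = cubeW n c S`, chart `e = redBond n π`, `ρ_W = restrictOp W e`:
* §1 lattice algebra — `restrictOp_comp_mulOp_cube` (`ρ_W∘M_g = M_{ρ_W g}∘ρ_W`), `abs_restrictOp_le_one`, `restrictOp_support_step` (a multiplier supported, with its `ν`-successors, in the
  window reads on the small torus as one supported, with its `ν`-successors, in the image cube), ★★ `restrictOp_comp_divAdj_comp_mulOp` (**the window restriction commutes with `∇*_ν`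
  behind such a multiplier**: `ρ_W∘∇*_ν∘M_g = ∇*′_ν∘ρ_W∘M_g` — the boundary fibre of `e` carries no mass of `g`), ★ `liftCubeG_comp_divAdj_comp_mulOp` (`G^{↑}∘∇*_ν∘M_g = (G(□′)∘∇*′_ν)^{↑}∘M_g`),
  ★★ `chiCube_liftCubeG_comp_divAdj_mulOp` (the record analogue of N-IId's sandwiched form: `χ_□∘G^{↑}∘∇*_ν∘M_g = transplant W e (Sym∘(G′∘∇*′_ν)∘M_{χ_{□′}})∘M_g`);
* §2 ★★ `hasMaj_transplant_gDivAdj_pair` — THE LIFTED SANDWICHED ENTRY-2 ROWS at BOTH spacings on the torus of record (N-IId `hasMaj_chiCube_symOp_gDivAdj_pair` through P-IId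
  `hasMaj_transplant_cube_family_spacing`), uniform in the volume; ★★ `hasMaj_chiCube_liftCubeG_divAdj_mulOp_pair` (the same read on `χ_□∘G^{↑}∘∇*_ν∘M_g` for `|g| ≤ 1` one step inside);
* §3 ★★★ **`hasMaj_idef_transplant_gDivAdj`** — THEIR TWO-GRID η-DEFECT: N-IIg `hasMaj_idef_chiCube_gDivAdj` (rate `(L^k)^{−1∕(8(d+1))}`, `4 ≤ L^k`) through P-IIc
  `hasMaj_idef_transplant_cube_family`, for every `s ≤ m_T`, `k ≥ 1`, `r`, corner, direction — uniform in the volume.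
HONEST FRAMING.  Lattice algebra + block-majorant bookkeeping over LANDED rows ((1.110) letters via `ineq110_114_pair`); no new analytic estimate; `U ≡ 1` torus MODEL of [B5] §1 (cube
tori `2L^s` lifted to the torus of record by programme P); nothing of [B6] (2.38)–(2.40)∕[B9] asserted; N15 NOT discharged (object-bound; NE2⁺ NOT PRINTED); counts UNMOVED (typed 28∕28 ·
discharged 5∕27); one finite torus pair per index — NOT continuum ∕ ℝ⁴ ∕ OS ∕ mass gap ∕ Clay.  Theorems only (0 `def`).
-/

noncomputable section

open scoped BigOperators Matrix
open Finset

namespace Summit.QuantumFields.YangMills.BalabanUVNodes.N15.TwoGrid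

open Literature.MathematicalPhysics.QuantumFieldTheory.Balaban1983to89
open Literature.MathematicalPhysics.QuantumFieldTheory.Balaban1983to89.B5Prop11Plancherel (Tor fine unitVec)
open Literature.MathematicalPhysics.QuantumFieldTheory.Balaban1983to89.B6Prop26Gluing (mulOp mulOp_apply ind ind_nonneg ind_le_one)
open Literature.MathematicalPhysics.QuantumFieldTheory.Balaban1983to89.B6Prop26ReachTransplant (restrictOp extendOp transplant restrictOp_apply restrictOp_apply_of_injOn
  restrictOp_apply_of_not_mem transplant_apply)
open Literature.MathematicalPhysics.QuantumFieldTheory.King1986.Torus (blockOf tdistT)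
open Literature.MathematicalPhysics.QuantumFieldTheory.Balaban1983to89.T4EtaRateDefect (idef)
open Literature.MathematicalPhysics.QuantumFieldTheory.Balaban1983to89.T4EtaRateCoeffDefect (pull)
open Literature.MathematicalPhysics.QuantumFieldTheory.Balaban1983to89.B11SectG (BlockNorm HasMaj)
open Literature.MathematicalPhysics.QuantumFieldTheory.Balaban1983to89.B6UnitTorusCarrier (unitTorusGeo)
open Literature.MathematicalPhysics.QuantumFieldTheory.Balaban1983to89.B5SiteBridgeP12 (MP)
open Summit.QuantumFields.YangMills.BalabanUVNodes.N15.VectorPiece (kingPrV blkFine)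
open Summit.QuantumFields.YangMills.BalabanUVNodes.N15.Gluing (hasMaj_comp_mulOp_loc)

variable {d : ℕ}

/-! ## §1 The window restriction, a source multiplier one step inside the cube, and the adjoint difference -/

section Algebra

variable (n : ℕ) [NeZero n] {M M' : Fin (d + 1) → ℕ} [∀ μ, NeZero (M μ)] [∀ μ, NeZero (M' μ)] (hM : ∀ μ, M' μ ∣ M μ) (c : Tor M) (S : ℕ)

/-- `ρ_W ∘ M_g = M_{ρ_W g} ∘ ρ_W`: behind an injective chart a source multiplier transports to the small torus as the multiplier `ρ_W g`. [folklore] -/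
theorem restrictOp_comp_mulOp_cube (hS : ∀ ν, S ≤ M' ν) (g : Tor (fine n M) × Fin (d + 1) → ℝ) :
    restrictOp (cubeW n c S) (redBond n hM) ∘ₗ mulOp g =
      mulOp (restrictOp (cubeW n c S) (redBond n hM) g) ∘ₗ restrictOp (cubeW n c S) (redBond n hM) := by
  have hinj := redBond_injOn_cubeW (n := n) (hM := hM) (c := c) (S := S) hS
  refine LinearMap.ext fun A => funext fun b' => ?_
  rw [LinearMap.comp_apply, LinearMap.comp_apply, mulOp_apply]
  by_cases h : ∃ b ∈ cubeW n c S, redBond n hM b = b'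
  · obtain ⟨b, hb, rfl⟩ := h
    rw [restrictOp_apply_of_injOn hinj _ hb, restrictOp_apply_of_injOn hinj _ hb, restrictOp_apply_of_injOn hinj _ hb, mulOp_apply]
  · push Not at h
    simp only [restrictOp_apply_of_not_mem _ h, mul_zero]

/-- `|g| ≤ 1 ⟹ |ρ_W g| ≤ 1`. [folklore] -/
theorem abs_restrictOp_le_one (hS : ∀ ν, S ≤ M' ν) {g : Tor (fine n M) × Fin (d + 1) → ℝ} (hg : ∀ b, |g b| ≤ 1) (b' : Tor (fine n M') × Fin (d + 1)) :
    |restrictOp (cubeW n c S) (redBond n hM) g b'| ≤ 1 := by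
  by_cases h : ∃ b ∈ cubeW n c S, redBond n hM b = b'
  · obtain ⟨b, hb, rfl⟩ := h
    rw [restrictOp_apply_of_injOn (redBond_injOn_cubeW hS) _ hb]
    exact hg b
  · push Not at h
    rw [restrictOp_apply_of_not_mem _ h, abs_zero]
    exact zero_le_one

omit [NeZero n] [∀ μ, NeZero (M μ)] [∀ μ, NeZero (M' μ)] in
/-- the chart moves a bond and its `ν`-successor together: `e(x + e_ν, μ) = ((e(x, μ)).1 + e_ν, μ)`. [folklore] -/
theorem redBond_add_unitVec (b : Tor (fine n M) × Fin (d + 1)) (ν : Fin (d + 1)) :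
    redBond n hM (b.1 + unitVec (fine n M) ν, b.2) = ((redBond n hM b).1 + unitVec (fine n M') ν, (redBond n hM b).2) := by
  simp only [redBond, torRed_add_unitVec]

omit [NeZero n] [∀ μ, NeZero (M μ)] [∀ μ, NeZero (M' μ)] in
/-- … and its `ν`-predecessor: `e(x − e_ν, μ) = ((e(x, μ)).1 − e_ν, μ)`. [folklore] -/
theorem redBond_sub_unitVec (b : Tor (fine n M) × Fin (d + 1)) (ν : Fin (d + 1)) :
    redBond n hM (b.1 - unitVec (fine n M) ν, b.2) = ((redBond n hM b).1 - unitVec (fine n M') ν, (redBond n hM b).2) := by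
  simp only [redBond, torRed_sub_unitVec]

/-- ★ SUPPORT TRANSPORT: a multiplier supported, together with its `ν`-successors, in the window reads on the small torus (`ρ_W g`) as a multiplier supported, together with its
`ν`-successors, in the blocks of the image cube `□′ + πc` — the hypothesis of N-IId `chiCube_neumannCubeG_comp_divAdj_mulOp` on the cube torus. [folklore] -/
theorem restrictOp_support_step (hS : ∀ ν, S ≤ M' ν) (ν : Fin (d + 1)) {g : Tor (fine n M) × Fin (d + 1) → ℝ}
    (hg : ∀ b, g b ≠ 0 → b ∈ cubeW n c S ∧ (b.1 + unitVec (fine n M) ν, b.2) ∈ cubeW n c S) (b' : Tor (fine n M') × Fin (d + 1))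
    (hb' : restrictOp (cubeW n c S) (redBond n hM) g b' ≠ 0) :
    blockOf n M' b'.1 ∈ cubeBlocks M' (torRed hM c) S ∧ blockOf n M' (b'.1 + unitVec (fine n M') ν) ∈ cubeBlocks M' (torRed hM c) S := by
  by_cases h : ∃ b ∈ cubeW n c S, redBond n hM b = b'
  · obtain ⟨b, hb, rfl⟩ := h
    rw [restrictOp_apply_of_injOn (redBond_injOn_cubeW hS) _ hb] at hb'
    obtain ⟨h1, h2⟩ := hg b hb'
    rw [mem_cubeW] at h1 h2
    refine ⟨?_, ?_⟩
    · show blockOf n M' (torRed (fine_dvd n hM) b.1) ∈ _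
      rw [kingBlockOf_torRed]
      exact torRed_mem_cubeBlocks hS h1
    · show blockOf n M' (torRed (fine_dvd n hM) b.1 + unitVec (fine n M') ν) ∈ _
      rw [← torRed_add_unitVec, kingBlockOf_torRed]
      exact torRed_mem_cubeBlocks hS h2
  · push Not at h
    exact absurd (restrictOp_apply_of_not_mem _ h) hb'

/-- ★★ **THE WINDOW RESTRICTION COMMUTES WITH THE ADJOINT DIFFERENCE BEHIND A MULTIPLIER ONE STEP INSIDE**: if `supp g ⊂ W` and `supp g + e_ν ⊂ W` then
`ρ_W ∘ ∇*_ν ∘ M_g = ∇*′_ν ∘ ρ_W ∘ M_g` (`∇*_ν = ρ(c•(s_ν⁻¹ − 1))` on either torus) — on the image of the window the two tori's backward steps agree (`π(x − e_ν) = πx − e_ν`), and a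
boundary fibre of the chart carries no mass of `g`: a bond of the window whose successor is read there would be `g`-charged with its successor outside the fibre's preimage,
contradicting injectivity. [cite: Balaban1984PropagatorsII, p.238 (T_□: functions on the cube ARE functions on its torus)] -/
theorem restrictOp_comp_divAdj_comp_mulOp (hS : ∀ ν, S ≤ M' ν) (ν : Fin (d + 1)) (cc : ℝ) {g : Tor (fine n M) × Fin (d + 1) → ℝ}
    (hg : ∀ b, g b ≠ 0 → b ∈ cubeW n c S ∧ (b.1 + unitVec (fine n M) ν, b.2) ∈ cubeW n c S) :
    restrictOp (cubeW n c S) (redBond n hM) ∘ₗ symbOp M n (cc • (sTinv M n ν - 1)) ∘ₗ mulOp g =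
      symbOp M' n (cc • (sTinv M' n ν - 1)) ∘ₗ restrictOp (cubeW n c S) (redBond n hM) ∘ₗ mulOp g := by
  have hinj := redBond_injOn_cubeW (n := n) (hM := hM) (c := c) (S := S) hS
  refine LinearMap.ext fun A => funext fun b' => ?_
  simp only [LinearMap.comp_apply]
  set F : Tor (fine n M) × Fin (d + 1) → ℝ := mulOp g A with hFdef
  have hF0 : ∀ b, b ∉ cubeW n c S → F b = 0 := fun b hb => by
    rw [hFdef, mulOp_apply]
    by_cases h0 : g b = 0
    · rw [h0, zero_mul]
    · exact absurd (hg b h0).1 hb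
  have hFsucc : ∀ b, F b ≠ 0 → (b.1 + unitVec (fine n M) ν, b.2) ∈ cubeW n c S := fun b hb => by
    rw [hFdef, mulOp_apply] at hb
    exact (hg b (left_ne_zero_of_mul hb)).2
  -- the fibre of the chart over `e b₀ − e_ν` (any `b₀ ∈ W`... or any point) carries no `F`-mass unless it is the predecessor itself
  have hfib : ∀ b₀ : Tor (fine n M) × Fin (d + 1), b₀ ∈ cubeW n c S → (b₀.1 - unitVec (fine n M) ν, b₀.2) ∉ cubeW n c S →
      restrictOp (cubeW n c S) (redBond n hM) F (redBond n hM (b₀.1 - unitVec (fine n M) ν, b₀.2)) = 0 := by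
    intro b₀ hb₀ hpred
    rw [restrictOp_apply]
    refine Finset.sum_eq_zero fun b₁ hb₁ => ?_
    rw [Finset.mem_filter] at hb₁
    by_contra hne
    have hsucc := hFsucc b₁ hne
    have e1 : redBond n hM (b₁.1 + unitVec (fine n M) ν, b₁.2) = redBond n hM b₀ := by
      rw [redBond_add_unitVec, hb₁.2, redBond_sub_unitVec, sub_add_cancel]
    have e2 : (b₁.1 + unitVec (fine n M) ν, b₁.2) = b₀ := hinj hsucc hb₀ e1
    apply hpred
    rw [← e2]
    simpa using hb₁.1
  have hfib' : ∀ b' : Tor (fine n M') × Fin (d + 1), (∀ b ∈ cubeW n c S, redBond n hM b ≠ b') →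
      restrictOp (cubeW n c S) (redBond n hM) F (b'.1 - unitVec (fine n M') ν, b'.2) = 0 := by
    intro b' hb'
    rw [restrictOp_apply]
    refine Finset.sum_eq_zero fun b₁ hb₁ => ?_
    rw [Finset.mem_filter] at hb₁
    by_contra hne
    have hsucc := hFsucc b₁ hne
    have e1 : redBond n hM (b₁.1 + unitVec (fine n M) ν, b₁.2) = b' := by
      rw [redBond_add_unitVec, hb₁.2]
      simp
    exact hb' _ hsucc e1
  by_cases h : ∃ b ∈ cubeW n c S, redBond n hM b = b'
  · obtain ⟨b, hb, rfl⟩ := h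
    rw [restrictOp_apply_of_injOn hinj _ hb, symbOp_divAdj_apply, symbOp_divAdj_apply, restrictOp_apply_of_injOn hinj _ hb, ← redBond_sub_unitVec]
    by_cases hbm : (b.1 - unitVec (fine n M) ν, b.2) ∈ cubeW n c S
    · rw [restrictOp_apply_of_injOn hinj _ hbm]
    · rw [hF0 _ hbm, hfib b hb hbm]
  · push Not at h
    rw [restrictOp_apply_of_not_mem _ h, symbOp_divAdj_apply, restrictOp_apply_of_not_mem _ h, hfib' b' h, sub_zero, mul_zero]

/-- ★ hence `∇*_ν` slips inside the lift behind such a multiplier: `G^{↑}(□) ∘ ∇*_ν ∘ M_g = (G(□′) ∘ ∇*′_ν)^{↑} ∘ M_g`. [folklore] -/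
theorem liftCubeG_comp_divAdj_comp_mulOp (hS : ∀ ν, S ≤ M' ν) (a : ℝ) (ν : Fin (d + 1)) (cc : ℝ) {g : Tor (fine n M) × Fin (d + 1) → ℝ}
    (hg : ∀ b, g b ≠ 0 → b ∈ cubeW n c S ∧ (b.1 + unitVec (fine n M) ν, b.2) ∈ cubeW n c S) :
    liftCubeG n hM c S a ∘ₗ symbOp M n (cc • (sTinv M n ν - 1)) ∘ₗ mulOp g =
      liftOp n hM c S (neumannCubeG M' n (torRed hM c) S a ∘ₗ symbOp M' n (cc • (sTinv M' n ν - 1))) ∘ₗ mulOp g := by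
  rw [liftCubeG_eq_liftOp, liftOp, liftOp]
  simp only [LinearMap.comp_assoc]
  rw [restrictOp_comp_divAdj_comp_mulOp n hM c S hS ν cc hg]

/-- ★★ **THE RECORD ANALOGUE OF N-IId's SANDWICHED FORM**: for `|g|`-any multiplier supported, with its `ν`-successors, in the window (`S ≤ M′_ν = 2S′`... any `M′` with `S ≤ M′_ν`,
`n ≥ 1`, `a > 0`, `M′_ν = 2S`): `χ_□ ∘ G^{↑}(□) ∘ ∇*_ν ∘ M_g = transplant W e (Sym ∘ (G′∘∇*′_ν) ∘ M_{χ_{□′}}) ∘ M_g` — the derivative slips inside the lift AND inside the source cut of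
the image cube, exactly. [folklore] -/
theorem chiCube_liftCubeG_comp_divAdj_mulOp (hM2 : ∀ ν, M' ν = 2 * S) (hn : 1 ≤ n) {a : ℝ} (ha : 0 < a) (ν : Fin (d + 1)) {g : Tor (fine n M) × Fin (d + 1) → ℝ}
    (hg : ∀ b, g b ≠ 0 → b ∈ cubeW n c S ∧ (b.1 + unitVec (fine n M) ν, b.2) ∈ cubeW n c S) :
    mulOp (chiCube M n c S) ∘ₗ liftCubeG n hM c S a ∘ₗ symbOp M n ((n : ℝ) • (sTinv M n ν - 1)) ∘ₗ mulOp g =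
      transplant (cubeW n c S) (redBond n hM)
          (symOp M' n (torRed hM c) ∘ₗ (gOp M' n a ∘ₗ symbOp M' n ((n : ℝ) • (sTinv M' n ν - 1))) ∘ₗ mulOp (chiCube M' n (torRed hM c) S)) ∘ₗ mulOp g := by
  have hS : ∀ ν, S ≤ M' ν := fun ν => by rw [hM2 ν]; omega
  have hg' := restrictOp_support_step n hM c S hS ν hg
  have hχ1 : ∀ b ∈ cubeW n c S, chiCube M' n (torRed hM c) S (redBond n hM b) = 1 := fun b hb => chiCube_redBond_of_mem (n := n) (hM := hM) (c := c) (S := S) hS hb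
  -- (1) `∇*` slips inside the lift, the cut lift is the transplant, the multiplier transports to the small torus
  have e1 : mulOp (chiCube M n c S) ∘ₗ liftCubeG n hM c S a ∘ₗ symbOp M n ((n : ℝ) • (sTinv M n ν - 1)) ∘ₗ mulOp g =
      extendOp (cubeW n c S) (redBond n hM) ∘ₗ neumannCubeG M' n (torRed hM c) S a ∘ₗ symbOp M' n ((n : ℝ) • (sTinv M' n ν - 1)) ∘ₗ
        mulOp (restrictOp (cubeW n c S) (redBond n hM) g) ∘ₗ restrictOp (cubeW n c S) (redBond n hM) := by
    rw [liftCubeG_comp_divAdj_comp_mulOp n hM c S hS a ν _ hg, ← LinearMap.comp_assoc, mulOp_chiCube_comp_liftOp, transplant]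
    simp only [LinearMap.comp_assoc]
    rw [restrictOp_comp_mulOp_cube n hM c S hS g]
  -- (2) N-IId's identity on the small torus, read through the transplant (the output cut of the image cube is invisible behind `extendOp`)
  have key := chiCube_neumannCubeG_comp_divAdj_mulOp hM2 hn ha ν hg'
  simp only [LinearMap.comp_assoc] at key
  have key2 := congrArg (transplant (cubeW n c S) (redBond n hM)) key
  rw [transplant_mulOp_comp_of_eq_one hχ1, transplant_mulOp_comp_of_eq_one hχ1, transplant, transplant] at key2
  simp only [LinearMap.comp_assoc] at key2
  rw [e1, key2, transplant]
  simp only [LinearMap.comp_assoc]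
  rw [restrictOp_comp_mulOp_cube n hM c S hS g]

end Algebra

/-! ## §2 The lifted sandwiched entry-2 rows at both spacings on the torus of record -/

section Rows

variable {L : ℕ} [NeZero L]

/-- ★★ **THE LIFTED SANDWICHED ENTRY-2 ROWS ON THE TORUS OF RECORD, BOTH SPACINGS** (`transplant W e (Sym∘(G′∘∇*′_ν)∘M_{χ_{□′}})` at `n = L^k` in King's unit blocks and at
`n′ = L^r·L^k` in the blocks read through the pairing), N-IId's constants, for EVERY `s ≤ m_T`, `k ≥ 1`, `r`, corner `c`, direction `ν` — uniform in the volume: N-IId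
`hasMaj_chiCube_symOp_gDivAdj_pair` through P-IId `hasMaj_transplant_cube_family_spacing`. [cite: Balaban1984PropagatorsII, (2.133) p.247 (shape), p.238 (T_□); Balaban1984PropagatorsI,
Prop. 1.2 (1.110) p.35 (entry «G∇*»)] -/
theorem hasMaj_transplant_gDivAdj_pair (hL : Odd L ∧ 1 < L) {a : ℝ} (ha : 0 < a) :
    ∃ δ β : ℝ, 0 < δ ∧ 0 < β ∧ ∀ (s mT k r : ℕ) (hs : s ≤ mT) (hk : 1 ≤ k) (c : Tor (MP (paramsOf d L mT k hL))) (ν : Fin (d + 1)),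
      HasMaj (BlockNorm.ofBlocks (unitTorusGeo L k (MP (paramsOf d L mT k hL)))
          (fun i : Tor (fine (L ^ k) (MP (paramsOf d L mT k hL))) × Fin (d + 1) => blockOf (L ^ k) (MP (paramsOf d L mT k hL)) i.1))
        (BlockNorm.ofBlocks (unitTorusGeo L k (MP (paramsOf d L mT k hL)))
          (fun i : Tor (fine (L ^ k) (MP (paramsOf d L mT k hL))) × Fin (d + 1) => blockOf (L ^ k) (MP (paramsOf d L mT k hL)) i.1))
        (transplant (cubeW (L ^ k) c (L ^ s)) (redBond (L ^ k) (MP_dvd_MP hL hs k))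
          (symOp (MP (paramsOf d L s k hL)) (L ^ k) (torRed (MP_dvd_MP hL hs k) c) ∘ₗ
            (gOp (MP (paramsOf d L s k hL)) (L ^ k) a ∘ₗ
              symbOp (MP (paramsOf d L s k hL)) (L ^ k) (((L ^ k : ℕ) : ℝ) • (sTinv (MP (paramsOf d L s k hL)) (L ^ k) ν - 1))) ∘ₗ
            mulOp (chiCube (MP (paramsOf d L s k hL)) (L ^ k) (torRed (MP_dvd_MP hL hs k) c) (L ^ s))))
        (fun y y' => ind ((cubeBlocks (MP (paramsOf d L mT k hL)) c (L ^ s) : Finset _) : Set _) y *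
          ind ((cubeBlocks (MP (paramsOf d L mT k hL)) c (L ^ s) : Finset _) : Set _) y' * (β * Real.exp (-(δ * tdistT (MP (paramsOf d L mT k hL)) y y')))) ∧
      HasMaj (BlockNorm.ofBlocks (unitTorusGeo L k (MP (paramsOf d L mT k hL)))
          (fun i : Tor (fine (L ^ r * L ^ k) (MP (paramsOf d L mT k hL))) × Fin (d + 1) => blockOf (L ^ r * L ^ k) (MP (paramsOf d L mT k hL)) i.1))
        (BlockNorm.ofBlocks (unitTorusGeo L k (MP (paramsOf d L mT k hL)))
          (fun i : Tor (fine (L ^ r * L ^ k) (MP (paramsOf d L mT k hL))) × Fin (d + 1) => blockOf (L ^ r * L ^ k) (MP (paramsOf d L mT k hL)) i.1))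
        (transplant (cubeW (L ^ r * L ^ k) c (L ^ s)) (redBond (L ^ r * L ^ k) (MP_dvd_MP hL hs k))
          (symOp (MP (paramsOf d L s k hL)) (L ^ r * L ^ k) (torRed (MP_dvd_MP hL hs k) c) ∘ₗ
            (gOp (MP (paramsOf d L s k hL)) (L ^ r * L ^ k) a ∘ₗ
              symbOp (MP (paramsOf d L s k hL)) (L ^ r * L ^ k) (((L ^ r * L ^ k : ℕ) : ℝ) • (sTinv (MP (paramsOf d L s k hL)) (L ^ r * L ^ k) ν - 1))) ∘ₗ
            mulOp (chiCube (MP (paramsOf d L s k hL)) (L ^ r * L ^ k) (torRed (MP_dvd_MP hL hs k) c) (L ^ s))))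
        (fun y y' => ind ((cubeBlocks (MP (paramsOf d L mT k hL)) c (L ^ s) : Finset _) : Set _) y *
          ind ((cubeBlocks (MP (paramsOf d L mT k hL)) c (L ^ s) : Finset _) : Set _) y' * (β * Real.exp (-(δ * tdistT (MP (paramsOf d L mT k hL)) y y')))) := by
  obtain ⟨δ, β, hδ, hβ, H⟩ := hasMaj_chiCube_symOp_gDivAdj_pair (d := d) hL ha
  refine ⟨δ, β, hδ, hβ, fun s mT k r hs hk c ν => ⟨?_, ?_⟩⟩
  · exact hasMaj_transplant_cube_family_spacing hL hs (L ^ k) c _ hβ.le (H s k r hk (torRed (MP_dvd_MP hL hs k) c) ν).1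
  · exact hasMaj_transplant_cube_family_spacing hL hs (L ^ r * L ^ k) c _ hβ.le (H s k r hk (torRed (MP_dvd_MP hL hs k) c) ν).2

/-- ★★ **THE SAME ROWS READ ON THE LIFTED OPERATOR**: for a source multiplier `|g| ≤ 1` supported, with its `ν`-successors, in the window of the cube (FILE 48's partition factor `h_k∘e`
one step inside `□_k`), `χ_□ ∘ G^{↑}(□) ∘ ∇*_ν ∘ M_g ≤ 1_□1_□·β·e^{−δ|y−y′|_T}` at the coarse spacing AND (primed) at the fine spacing, uniform in the volume — ★★
`hasMaj_transplant_gDivAdj_pair` behind ★★ `chiCube_liftCubeG_comp_divAdj_mulOp`, the multiplier costing nothing (`hasMaj_comp_mulOp_loc`). [cite: Balaban1984PropagatorsII, (2.133)–(2.134) p.247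
(shapes); Balaban1984PropagatorsI, Prop. 1.2 (1.110) p.35] -/
theorem hasMaj_chiCube_liftCubeG_divAdj_mulOp_pair (hL : Odd L ∧ 1 < L) {a : ℝ} (ha : 0 < a) :
    ∃ δ β : ℝ, 0 < δ ∧ 0 < β ∧ ∀ (s mT k r : ℕ) (hs : s ≤ mT) (hk : 1 ≤ k) (c : Tor (MP (paramsOf d L mT k hL))) (ν : Fin (d + 1))
      (g : Tor (fine (L ^ k) (MP (paramsOf d L mT k hL))) × Fin (d + 1) → ℝ) (g' : Tor (fine (L ^ r * L ^ k) (MP (paramsOf d L mT k hL))) × Fin (d + 1) → ℝ)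
      (_hg1 : ∀ b, |g b| ≤ 1) (_hg : ∀ b, g b ≠ 0 → b ∈ cubeW (L ^ k) c (L ^ s) ∧ (b.1 + unitVec (fine (L ^ k) (MP (paramsOf d L mT k hL))) ν, b.2) ∈ cubeW (L ^ k) c (L ^ s))
      (_hg1' : ∀ b, |g' b| ≤ 1)
      (_hg' : ∀ b, g' b ≠ 0 → b ∈ cubeW (L ^ r * L ^ k) c (L ^ s) ∧ (b.1 + unitVec (fine (L ^ r * L ^ k) (MP (paramsOf d L mT k hL))) ν, b.2) ∈ cubeW (L ^ r * L ^ k) c (L ^ s)),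
      HasMaj (BlockNorm.ofBlocks (unitTorusGeo L k (MP (paramsOf d L mT k hL)))
          (fun i : Tor (fine (L ^ k) (MP (paramsOf d L mT k hL))) × Fin (d + 1) => blockOf (L ^ k) (MP (paramsOf d L mT k hL)) i.1))
        (BlockNorm.ofBlocks (unitTorusGeo L k (MP (paramsOf d L mT k hL)))
          (fun i : Tor (fine (L ^ k) (MP (paramsOf d L mT k hL))) × Fin (d + 1) => blockOf (L ^ k) (MP (paramsOf d L mT k hL)) i.1))
        (mulOp (chiCube (MP (paramsOf d L mT k hL)) (L ^ k) c (L ^ s)) ∘ₗ liftCubeG (L ^ k) (MP_dvd_MP hL hs k) c (L ^ s) a ∘ₗ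
          symbOp (MP (paramsOf d L mT k hL)) (L ^ k) (((L ^ k : ℕ) : ℝ) • (sTinv (MP (paramsOf d L mT k hL)) (L ^ k) ν - 1)) ∘ₗ mulOp g)
        (fun y y' => ind ((cubeBlocks (MP (paramsOf d L mT k hL)) c (L ^ s) : Finset _) : Set _) y *
          ind ((cubeBlocks (MP (paramsOf d L mT k hL)) c (L ^ s) : Finset _) : Set _) y' * (β * 1 * Real.exp (-(δ * tdistT (MP (paramsOf d L mT k hL)) y y')))) ∧
      HasMaj (BlockNorm.ofBlocks (unitTorusGeo L k (MP (paramsOf d L mT k hL)))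
          (fun i : Tor (fine (L ^ r * L ^ k) (MP (paramsOf d L mT k hL))) × Fin (d + 1) => blockOf (L ^ r * L ^ k) (MP (paramsOf d L mT k hL)) i.1))
        (BlockNorm.ofBlocks (unitTorusGeo L k (MP (paramsOf d L mT k hL)))
          (fun i : Tor (fine (L ^ r * L ^ k) (MP (paramsOf d L mT k hL))) × Fin (d + 1) => blockOf (L ^ r * L ^ k) (MP (paramsOf d L mT k hL)) i.1))
        (mulOp (chiCube (MP (paramsOf d L mT k hL)) (L ^ r * L ^ k) c (L ^ s)) ∘ₗ liftCubeG (L ^ r * L ^ k) (MP_dvd_MP hL hs k) c (L ^ s) a ∘ₗ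
          symbOp (MP (paramsOf d L mT k hL)) (L ^ r * L ^ k) (((L ^ r * L ^ k : ℕ) : ℝ) • (sTinv (MP (paramsOf d L mT k hL)) (L ^ r * L ^ k) ν - 1)) ∘ₗ mulOp g')
        (fun y y' => ind ((cubeBlocks (MP (paramsOf d L mT k hL)) c (L ^ s) : Finset _) : Set _) y *
          ind ((cubeBlocks (MP (paramsOf d L mT k hL)) c (L ^ s) : Finset _) : Set _) y' * (β * 1 * Real.exp (-(δ * tdistT (MP (paramsOf d L mT k hL)) y y')))) := by
  obtain ⟨δ, β, hδ, hβ, H⟩ := hasMaj_transplant_gDivAdj_pair (d := d) hL ha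
  refine ⟨δ, β, hδ, hβ, fun s mT k r hs hk c ν g g' hg1 hg hg1' hg' => ⟨?_, ?_⟩⟩
  · have hM2 : ∀ μ, MP (paramsOf d L s k hL) μ = 2 * L ^ s := fun μ => rfl
    have hn : 1 ≤ L ^ k := Nat.one_le_pow _ _ (Nat.pos_of_ne_zero (NeZero.ne L))
    have e := chiCube_liftCubeG_comp_divAdj_mulOp (L ^ k) (MP_dvd_MP hL hs k) c (L ^ s) hM2 hn ha ν hg
    exact (hasMaj_comp_mulOp_loc (g := unitTorusGeo L k (MP (paramsOf d L mT k hL))) (blk := fun i : Tor (fine (L ^ k) (MP (paramsOf d L mT k hL))) × Fin (d + 1) => blockOf (L ^ k) (MP (paramsOf d L mT k hL)) i.1)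
      hβ.le zero_le_one hg1 (H s mT k r hs hk c ν).1).congr fun f => (LinearMap.congr_fun e f).symm
  · have hM2 : ∀ μ, MP (paramsOf d L s k hL) μ = 2 * L ^ s := fun μ => rfl
    have hn' : 1 ≤ L ^ r * L ^ k := Nat.one_le_iff_ne_zero.mpr (Nat.mul_ne_zero (pow_ne_zero r (NeZero.ne L)) (pow_ne_zero k (NeZero.ne L)))
    have e := chiCube_liftCubeG_comp_divAdj_mulOp (L ^ r * L ^ k) (MP_dvd_MP hL hs k) c (L ^ s) hM2 hn' ha ν hg'
    exact (hasMaj_comp_mulOp_loc (g := unitTorusGeo L k (MP (paramsOf d L mT k hL))) (blk := fun i : Tor (fine (L ^ r * L ^ k) (MP (paramsOf d L mT k hL))) × Fin (d + 1) => blockOf (L ^ r * L ^ k) (MP (paramsOf d L mT k hL)) i.1)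
      hβ.le zero_le_one hg1' (H s mT k r hs hk c ν).2).congr fun f => (LinearMap.congr_fun e f).symm

end Rows

/-! ## §3 The two-grid η-defect of the lifted sandwiched entry-2 rows -/

section Defect

variable {L : ℕ} [NeZero L]

/-- ★★★ **THE TWO-GRID η-DEFECT OF THE LIFTED SANDWICHED ENTRY-2 ROWS ON THE TORUS OF RECORD** (`𝔇(transplant W′ e′ Y′_ν, transplant W e Y_ν)` with
`Y_ν = Sym∘(G∘∇*_ν)∘M_{χ_{□′}}` on the cube torus at the two spacings): N-IIg's letter `1_□1_□·m·(L^k)^{−1∕(8(d+1))}·e^{−δd}` (for `4 ≤ L^k`), for EVERY `s ≤ m_T`, `k`, `r`, corner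
`c`, direction `ν` — uniform in the volume: N-IIg `hasMaj_idef_chiCube_gDivAdj` through P-IIc `hasMaj_idef_transplant_cube_family`.  With §1's identity this is the η-defect of
`χ_□∘G^{↑}∘∇*_ν∘M_g` up to the consumer's multiplier fit (Leibniz in `M_g`). [cite: Balaban1984PropagatorsII, (2.133)–(2.136) p.247 (shapes); Balaban1984PropagatorsI, (1.111) p.36,
(1.121)–(1.123) p.37; King1986, Prop. 3.9 p.665 (Hölder-rate shape)] -/
theorem hasMaj_idef_transplant_gDivAdj (hLodd : Odd L) (hL2 : 2 ≤ L) {a : ℝ} (ha : 0 < a) :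
    ∃ δ m : ℝ, 0 < δ ∧ 0 < m ∧ ∀ (s mT k r : ℕ) (hk : 1 ≤ k) (hn4 : 4 ≤ L ^ k) (hL : Odd L ∧ 1 < L) (hs : s ≤ mT) (c : Tor (MP (paramsOf d L mT k hL))) (ν : Fin (d + 1)),
      HasMaj (BlockNorm.ofBlocks (unitTorusGeo L k (MP (paramsOf d L mT k hL))) (blkFine L k (MP (paramsOf d L mT k hL))))
        (BlockNorm.ofBlocks (unitTorusGeo L k (MP (paramsOf d L mT k hL)))
          (fun i : Tor (fine (L ^ r * L ^ k) (MP (paramsOf d L mT k hL))) × Fin (d + 1) => blockOf (L ^ r * L ^ k) (MP (paramsOf d L mT k hL)) i.1))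
        (idef (pull (kingPrV L k r (MP (paramsOf d L mT k hL)))) (pull (kingPrV L k r (MP (paramsOf d L mT k hL))))
          (transplant (cubeW (L ^ r * L ^ k) c (L ^ s)) (redBond (L ^ r * L ^ k) (MP_dvd_MP hL hs k))
            (symOp (MP (paramsOf d L s k hL)) (L ^ r * L ^ k) (torRed (MP_dvd_MP hL hs k) c) ∘ₗ
              (gOp (MP (paramsOf d L s k hL)) (L ^ r * L ^ k) a ∘ₗ
                symbOp (MP (paramsOf d L s k hL)) (L ^ r * L ^ k) (((L ^ r * L ^ k : ℕ) : ℝ) • (sTinv (MP (paramsOf d L s k hL)) (L ^ r * L ^ k) ν - 1))) ∘ₗ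
              mulOp (chiCube (MP (paramsOf d L s k hL)) (L ^ r * L ^ k) (torRed (MP_dvd_MP hL hs k) c) (L ^ s))))
          (transplant (cubeW (L ^ k) c (L ^ s)) (redBond (L ^ k) (MP_dvd_MP hL hs k))
            (symOp (MP (paramsOf d L s k hL)) (L ^ k) (torRed (MP_dvd_MP hL hs k) c) ∘ₗ
              (gOp (MP (paramsOf d L s k hL)) (L ^ k) a ∘ₗ
                symbOp (MP (paramsOf d L s k hL)) (L ^ k) (((L ^ k : ℕ) : ℝ) • (sTinv (MP (paramsOf d L s k hL)) (L ^ k) ν - 1))) ∘ₗ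
              mulOp (chiCube (MP (paramsOf d L s k hL)) (L ^ k) (torRed (MP_dvd_MP hL hs k) c) (L ^ s)))))
        (fun y y' => ind ((cubeBlocks (MP (paramsOf d L mT k hL)) c (L ^ s) : Finset _) : Set _) y *
          ind ((cubeBlocks (MP (paramsOf d L mT k hL)) c (L ^ s) : Finset _) : Set _) y' *
          (m * ((L ^ k : ℕ) : ℝ) ^ (-(1 / (8 * ((d : ℝ) + 1)))) * Real.exp (-(δ * tdistT (MP (paramsOf d L mT k hL)) y y')))) := by
  obtain ⟨δ, m, hδ, hm, H⟩ := hasMaj_idef_chiCube_gDivAdj (d := d) hLodd hL2 ha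
  refine ⟨δ, m, hδ, hm, fun s mT k r hk hn4 hL hs c ν => ?_⟩
  have hρ : 0 ≤ m * ((L ^ k : ℕ) : ℝ) ^ (-(1 / (8 * ((d : ℝ) + 1)))) := mul_nonneg hm.le (Real.rpow_nonneg (Nat.cast_nonneg _) _)
  exact hasMaj_idef_transplant_cube_family (d := d) hL (r := r) hs c _ _ hρ (H s k r hk hn4 hL (torRed (MP_dvd_MP hL hs k) c) ν)

end Defect

end Summit.QuantumFields.YangMills.BalabanUVNodes.N15.TwoGrid

end
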